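import Summits.Ventures.PercRepro.Certify4
import Summits.Ventures.PercRepro.Antipodal

/-!
# PercRepro — the antipodal cone at `k = 4` and Lemma B on `{⊥, x₁, x₂, x₃, ⊤}` (p4, gen 10)

A second decidable certificate cone for quadratic forms of the law of four marked vertices, next
to typer-2's `SMC4` (`Certify4.lean`): an integer `15 × 15` kernel `A` (engine row order `rgs4`)
is **antipodal-certified**, `AP4 A`, when its diagonal is nonnegative and it is
**chain-submodular** on the refinement order of the fifteen partitions —
`A s s' + A t t' ≤ A s t' + A t s'` for all comparable pairs `s ≤ t`, `s' ≤ t'` (`compPairs4`,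
60 pairs; `decide`).

* `sum_flipOn_nonneg_of_AP4` — for every monotone `c : Config E → Setoid (Fin 4)` and every
  `S ⊆ E`, `0 ≤ Σ_σ A (c σ) (c (flipOn S σ))`: induction on `S`, pairing each `σ` with its flip at
  the new edge `g`; the two antipodal terms of the pair dominate the two terms of the smaller
  sub-cube by the chain inequality at `c σ ≤ c (flipEdge g σ)`, `c τ ≤ c (flipEdge g τ)`.
* **`AP4Principle_holds`** — every `AP4` kernel gives `0 ≤ quadForm4 A (G.law4 p a b c d)` for
  every finite multigraph, every `p ∈ [0,1]^E` and every four vertices (p4's antipodal principle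
  `quadForm_nonneg_of_antipodal` + typer-2's row bridge `quadForm_row4_eq_quadForm4`).
* **`A_bprime`, `bprime_law`** — the first ray: the kernel of Lemma B for the five-element
  quotient `{⊥} < M₁, M₂, M₃ < N` of the partition lattice, `M_i = {σ : ⊥ < σ ≤ x_i}` (the
  crossing cell `x_i` and the two single pairs below it), `N = {⊤} ∪ {the four 3|1 cells}`:
  `AP4 A_bprime` by `decide`, hence for every graph and every `p`
  `bot · P(a block of size ≥ 3) ≥ e₂(P(M₁), P(M₂), P(M₃))` — incomparable with C-005
  (both sides enlarged), a NEW inequality of the cell (proofs/P4-BPRIME.md).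

What the cone cannot do (proofs/P4-BPRIME.md §4): no kernel with `A(⊥,⊤) = 1`, `A(x_i,x_j) = -1`
and `A ≤ 0` elsewhere is in `AP4` — the `(⊥, 3|1)` entries are forced positive — so Lemma B itself
(C-005's kernel) is not an antipodal certificate; `A_bprime` is the closest one.
-/

namespace PercRepro

open Finset

/-! ### The refinement order on the fifteen rows -/

/-- The 60 comparable pairs `(s, t)` of engine rows with `rgs4 s` a refinement of `rgs4 t`
(every atom of `s` is an atom of `t`), the 15 diagonal pairs included. -/
def compPairs4 : Finset (Fin 15 × Fin 15) :=
  {(0, 0), (1, 0), (1, 1), (2, 0), (2, 2), (3, 0), (3, 3), (4, 0), (4, 1), (4, 2), (4, 3), (4, 4),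
    (5, 0), (5, 5), (6, 0), (6, 6), (7, 0), (7, 1), (7, 5), (7, 6), (7, 7), (8, 0), (8, 8), (9, 0),
    (9, 9), (10, 0), (10, 1), (10, 8), (10, 9), (10, 10), (11, 0), (11, 2), (11, 5), (11, 8),
    (11, 11), (12, 0), (12, 2), (12, 6), (12, 9), (12, 12), (13, 0), (13, 3), (13, 5), (13, 9),
    (13, 13), (14, 0), (14, 1), (14, 2), (14, 3), (14, 4), (14, 5), (14, 6), (14, 7), (14, 8),
    (14, 9), (14, 10), (14, 11), (14, 12), (14, 13), (14, 14)}

/-- **The antipodal cone condition at `k = 4`** on an integer `15 × 15` kernel (row order `rgs4`):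
nonnegative diagonal and chain-submodularity `A s s' + A t t' ≤ A s t' + A t s'` on all comparable
pairs `s ≤ t`, `s' ≤ t'` of the refinement order. Decidable. -/
def AP4 (A : Matrix (Fin 15) (Fin 15) ℤ) : Prop :=
  (∀ s, 0 ≤ A s s) ∧
    ∀ st ∈ compPairs4, ∀ st' ∈ compPairs4,
      A st.1 st'.1 + A st.2 st'.2 ≤ A st.1 st'.2 + A st.2 st'.1

/-- `AP4` is decidable (unfold and decide the finite conjunction). -/
instance : DecidablePred AP4 := fun _ => by unfold AP4; infer_instance

set_option maxRecDepth 8000 in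
/-- Rows with pointwise smaller atom vectors are comparable pairs (225 cases). -/
theorem mem_compPairs4_of_rows4_le :
    ∀ s t : Fin 15, (∀ a, rows4 s a = true → rows4 t a = true) → (s, t) ∈ compPairs4 := by
  decide +kernel

/-- The atom vector of the row of `σ` is the atom vector of `σ`. -/
theorem rows4_row4 (σ : Setoid (Fin 4)) : rows4 (row4 σ) = atoms4 σ :=
  ((rowOf4_eq_iff _ (isEquivAtoms4_atoms4 σ) _).1 rfl).symm

/-- Refinement of partitions is pointwise inclusion of atom vectors. -/
theorem atoms4_le_of_le {σ τ : Setoid (Fin 4)} (h : σ ≤ τ) (a : Fin 6)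
    (ha : atoms4 σ a = true) : atoms4 τ a = true := by
  simp only [atoms4, decide_eq_true_eq] at ha ⊢
  exact Setoid.le_def.1 h ha

/-- A refinement of partitions is a comparable pair of rows. -/
theorem row4_le_mem {σ τ : Setoid (Fin 4)} (h : σ ≤ τ) : (row4 σ, row4 τ) ∈ compPairs4 :=
  mem_compPairs4_of_rows4_le _ _ (by rw [rows4_row4, rows4_row4]; exact atoms4_le_of_le h)

/-- The chain inequality of a certified kernel, pulled back to partitions through `row4`. -/
theorem chain_of_AP4 {A : Matrix (Fin 15) (Fin 15) ℤ} (hA : AP4 A)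
    {σ τ σ' τ' : Setoid (Fin 4)} (h : σ ≤ τ) (h' : σ' ≤ τ') :
    (A (row4 σ) (row4 σ') : ℝ) + A (row4 τ) (row4 τ') ≤
      A (row4 σ) (row4 τ') + A (row4 τ) (row4 σ') := by
  have key := hA.2 (row4 σ, row4 τ) (row4_le_mem h) (row4 σ', row4 τ') (row4_le_mem h')
  dsimp only at key
  exact_mod_cast key

/-! ### The antipodal criterion on every sub-cube, by induction on the flipped edges -/

section Flip

variable {E : Type*} [Fintype E] [DecidableEq E]

omit [Fintype E] in
/-- A configuration with `g` closed lies below its flip at `g`. -/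
theorem le_flipEdge_of_false {σ : Config E} {g : E} (h : σ g = false) : σ ≤ flipEdge g σ := by
  intro e
  by_cases he : e = g
  · subst he
    simp [flipEdge, h]
  · simp [flipEdge, Function.update_of_ne he]

omit [Fintype E] in
/-- A configuration with `g` open lies above its flip at `g`. -/
theorem flipEdge_le_of_true {σ : Config E} {g : E} (h : σ g = true) : flipEdge g σ ≤ σ := by
  intro e
  by_cases he : e = g
  · subst he
    simp [flipEdge, h]
  · simp [flipEdge, Function.update_of_ne he]

omit [Fintype E] in
/-- Flipping on `S` does not see an edge outside `S`. -/
theorem flipOn_apply_of_notMem {S : Finset E} {g : E} (hg : g ∉ S) (σ : Config E) :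
    flipOn S σ g = σ g := by
  simp [flipOn, hg]

omit [Fintype E] in
/-- Flipping on `insert g S` is flipping on `S` followed by the flip at `g`. -/
theorem flipOn_insert_eq_flipEdge {S : Finset E} {g : E} (hg : g ∉ S) (σ : Config E) :
    flipOn (insert g S) σ = flipEdge g (flipOn S σ) := by
  rw [flipOn_insert, flipEdge, flipOn_apply_of_notMem hg]

omit [Fintype E] in
/-- Flipping on `S` commutes with the flip at an edge outside `S`. -/
theorem flipOn_flipEdge {S : Finset E} {g : E} (hg : g ∉ S) (σ : Config E) :
    flipOn S (flipEdge g σ) = flipEdge g (flipOn S σ) := by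
  rw [flipEdge, flipOn_update hg, flipEdge, flipOn_apply_of_notMem hg]

omit [Fintype E] in
/-- Flipping on `∅` is the identity. -/
theorem flipOn_empty (σ : Config E) : flipOn (∅ : Finset E) σ = σ := by
  funext e
  simp [flipOn]

/-- **Antipodal sums of a certified kernel are nonnegative on every sub-cube**: for a monotone
`c : Config E → Setoid (Fin 4)` and every `S ⊆ E`,
`0 ≤ Σ_σ A (row4 (c σ)) (row4 (c (flipOn S σ)))`. Induction on `S`: at the step `insert g S`
each `σ` is paired with its flip `σ' = flipEdge g σ`; with `τ = flipOn S σ`, `τ' = flipEdge g τ`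
the two new terms are `A (c σ) (c τ') + A (c σ') (c τ)` and the two old ones
`A (c σ) (c τ) + A (c σ') (c τ')`, dominated by the chain inequality along `σ ≤ σ'`, `τ ≤ τ'`
(or the reversed pair when `g` is open in `σ`). -/
theorem sum_flipOn_nonneg_of_AP4 {A : Matrix (Fin 15) (Fin 15) ℤ} (hA : AP4 A)
    (c : Config E → Setoid (Fin 4)) (hc : Monotone c) (S : Finset E) :
    0 ≤ ∑ σ : Config E, (A (row4 (c σ)) (row4 (c (flipOn S σ))) : ℝ) := by
  induction S using Finset.induction_on with
  | empty =>
    simp only [flipOn_empty]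
    exact Finset.sum_nonneg fun σ _ => by exact_mod_cast hA.1 _
  | insert g S hg ih =>
    have key : ∀ σ : Config E,
        (A (row4 (c σ)) (row4 (c (flipOn S σ))) : ℝ) +
            A (row4 (c (flipEdge g σ))) (row4 (c (flipOn S (flipEdge g σ)))) ≤
          (A (row4 (c σ)) (row4 (c (flipOn (insert g S) σ))) : ℝ) +
            A (row4 (c (flipEdge g σ))) (row4 (c (flipOn (insert g S) (flipEdge g σ)))) := by
      intro σ
      rw [flipOn_insert_eq_flipEdge hg, flipOn_insert_eq_flipEdge hg, flipOn_flipEdge hg,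
        flipEdge_flipEdge]
      have hτ : flipOn S σ g = σ g := flipOn_apply_of_notMem hg σ
      cases hσ : σ g with
      | false =>
        have h1 : σ ≤ flipEdge g σ := le_flipEdge_of_false hσ
        have h2 : flipOn S σ ≤ flipEdge g (flipOn S σ) :=
          le_flipEdge_of_false (by rw [hτ, hσ])
        exact chain_of_AP4 hA (hc h1) (hc h2)
      | true =>
        have h1 : flipEdge g σ ≤ σ := flipEdge_le_of_true hσ
        have h2 : flipEdge g (flipOn S σ) ≤ flipOn S σ :=
          flipEdge_le_of_true (by rw [hτ, hσ])
        have := chain_of_AP4 hA (hc h1) (hc h2)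
        linarith
    have hsum := Finset.sum_le_sum fun σ (_ : σ ∈ (Finset.univ : Finset (Config E))) => key σ
    rw [Finset.sum_add_distrib, Finset.sum_add_distrib,
      (flipEdge_involutive g).bijective.sum_comp
        (fun σ => (A (row4 (c σ)) (row4 (c (flipOn S σ))) : ℝ)),
      (flipEdge_involutive g).bijective.sum_comp
        (fun σ => (A (row4 (c σ)) (row4 (c (flipOn (insert g S) σ))) : ℝ))] at hsum
    linarith


/-- **Lemma B on the quotient, pair-count form**: for every finite `E` and every monotone
`c : Config E → Setoid (Fin 4)`, `0 ≤ Σ_σ A (row4 (c σ)) (row4 (c σᶜ))` for every certified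
kernel (the sub-cube `S = univ`, whose flip is the complement). -/
theorem sum_compl_nonneg_of_AP4 {A : Matrix (Fin 15) (Fin 15) ℤ} (hA : AP4 A)
    (c : Config E → Setoid (Fin 4)) (hc : Monotone c) :
    0 ≤ ∑ σ : Config E, (A (row4 (c σ)) (row4 (c σᶜ)) : ℝ) := by
  have h := sum_flipOn_nonneg_of_AP4 hA c hc Finset.univ
  have hu : ∀ σ : Config E, flipOn Finset.univ σ = σᶜ := fun σ => by
    funext e
    simp only [flipOn, Finset.mem_univ, if_true, Pi.compl_apply]
    rfl
  simpa only [hu] using h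

omit [Fintype E] in
/-- Patching `S` with the flipped states is flipping `S` after patching. -/
theorem patch_flipOn (S : Finset E) (σ ω₀ : Config E) :
    patch S (flipOn S σ) ω₀ = flipOn S (patch S σ ω₀) := by
  funext e
  by_cases he : e ∈ S <;> simp [patch, flipOn, he]

omit [Fintype E] in
/-- Patching is monotone in the patched states. -/
theorem patch_mono (S : Finset E) (ω₀ : Config E) : Monotone fun σ => patch S σ ω₀ := by
  intro σ σ' h e
  by_cases he : e ∈ S
  · simpa [patch, he] using h e
  · simp [patch, he]

end Flip

/-! ### The antipodal principle at `k = 4` in certificate form -/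

namespace MultiGraph

variable {V E : Type*} (G : MultiGraph V E) [Fintype E] [DecidableEq E]

/-- The antipodal criterion of `quadForm_nonneg_of_antipodal` holds for every certified kernel:
the marked partition of the patched configurations is a monotone map of the patched states. -/
theorem antipodal_base_of_AP4 {A : Matrix (Fin 15) (Fin 15) ℤ} (hA : AP4 A) (m : Fin 4 → V)
    (S : Finset E) (ω₀ : Config E) :
    0 ≤ ∑ σ : Config E, (A (row4 (G.markedPartition (patch S σ ω₀) m))
      (row4 (G.markedPartition (patch S (flipOn S σ) ω₀) m)) : ℝ) := by
  have hmono : Monotone fun σ => G.markedPartition (patch S σ ω₀) m :=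
    (G.markedPartition_mono m).comp (patch_mono S ω₀)
  have h := sum_flipOn_nonneg_of_AP4 hA _ hmono S
  simpa only [patch_flipOn] using h

/-- **Every antipodal-certified kernel has a nonnegative quadratic form at the law of four marked
vertices**, for every finite multigraph, every `p ∈ [0,1]^E` and every four vertices (p4's
antipodal principle `quadForm_nonneg_of_antipodal` + typer-2's row bridge
`quadForm_row4_eq_quadForm4`). -/
theorem quadForm4_nonneg_of_AP4 {A : Matrix (Fin 15) (Fin 15) ℤ} (hA : AP4 A) (p : E → ℝ)
    (hp : IsProb p) (a b c d : V) : 0 ≤ quadForm4 A (G.law4 p a b c d) := by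
  have h := G.quadForm_nonneg_of_antipodal ![a, b, c, d]
    (fun σ τ => (A (row4 σ) (row4 τ) : ℝ))
    (fun S ω₀ => G.antipodal_base_of_AP4 hA ![a, b, c, d] S ω₀) hp
  rwa [G.quadForm_row4_eq_quadForm4] at h

end MultiGraph

/-- **The antipodal principle at `k = 4` as a named Prop**: every `AP4` kernel gives a nonnegative
quadratic form at every law of four marked vertices. -/
def AP4Principle : Prop :=
  ∀ A : Matrix (Fin 15) (Fin 15) ℤ, AP4 A →
    ∀ {V E : Type} [Fintype E] [DecidableEq E] (G : MultiGraph V E) (p : E → ℝ), IsProb p →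
      ∀ a b c d : V, 0 ≤ quadForm4 A (G.law4 p a b c d)

/-- **The antipodal principle at `k = 4` holds**: every kernel certified by `AP4 A := by decide`
is a theorem for every finite multigraph, weights and marking (from p4's antipodal principle and
typer-2's row bridge). -/
theorem AP4Principle_holds : AP4Principle :=
  fun _ hA _ _ _ _ G p hp a b c d => G.quadForm4_nonneg_of_AP4 hA p hp a b c d

/-! ### The first ray: Lemma B on the five-element quotient `{⊥} < M₁, M₂, M₃ < N` -/

/-- The kernel of Lemma B for the quotient `{⊥} < M₁, M₂, M₃ < N` of the partition lattice
(rows: `M₁ = {3, 4, 13}` = `ab|cd, ab|c|d, a|b|cd`; `M₂ = {6, 7, 12}`; `M₃ = {8, 10, 11}`;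
`N = {0, 1, 2, 5, 9}` = `⊤` and the four `3|1` cells; `⊥ = 14`): `+1` on `(⊥, N)`, `-1` on
`(M_i, M_j)` for `i ≠ j`, `0` elsewhere. -/
def A_bprime : Matrix (Fin 15) (Fin 15) ℤ :=
  Matrix.of ![![0, 0, 0, 0, 0, 0, 0, 0, 0, 0, 0, 0, 0, 0, 1],
    ![0, 0, 0, 0, 0, 0, 0, 0, 0, 0, 0, 0, 0, 0, 1],
    ![0, 0, 0, 0, 0, 0, 0, 0, 0, 0, 0, 0, 0, 0, 1],
    ![0, 0, 0, 0, 0, 0, -1, -1, -1, 0, -1, -1, -1, 0, 0],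
    ![0, 0, 0, 0, 0, 0, -1, -1, -1, 0, -1, -1, -1, 0, 0],
    ![0, 0, 0, 0, 0, 0, 0, 0, 0, 0, 0, 0, 0, 0, 1],
    ![0, 0, 0, -1, -1, 0, 0, 0, -1, 0, -1, -1, 0, -1, 0],
    ![0, 0, 0, -1, -1, 0, 0, 0, -1, 0, -1, -1, 0, -1, 0],
    ![0, 0, 0, -1, -1, 0, -1, -1, 0, 0, 0, 0, -1, -1, 0],
    ![0, 0, 0, 0, 0, 0, 0, 0, 0, 0, 0, 0, 0, 0, 1],
    ![0, 0, 0, -1, -1, 0, -1, -1, 0, 0, 0, 0, -1, -1, 0],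
    ![0, 0, 0, -1, -1, 0, -1, -1, 0, 0, 0, 0, -1, -1, 0],
    ![0, 0, 0, -1, -1, 0, 0, 0, -1, 0, -1, -1, 0, -1, 0],
    ![0, 0, 0, 0, 0, 0, -1, -1, -1, 0, -1, -1, -1, 0, 0],
    ![1, 1, 1, 0, 0, 1, 0, 0, 0, 1, 0, 0, 0, 0, 0]]

set_option maxRecDepth 8000 in
/-- `A_bprime` is antipodal-certified (60 × 60 chain inequalities, kernel `decide`). -/
theorem AP4_A_bprime : AP4 A_bprime := by decide +kernel


/-- The kernel of C-005 itself, `top · bot - e₂(x₁, x₂, x₃)` (rows `⊤ = 0`, `⊥ = 14`, crossing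
`3, 6, 8`), symmetrised. -/
def A_c005 : Matrix (Fin 15) (Fin 15) ℤ := fun s t =>
  (if (s = 14 ∧ t = 0) ∨ (s = 0 ∧ t = 14) then 1 else 0) -
    (if (s = 3 ∨ s = 6 ∨ s = 8) ∧ (t = 3 ∨ t = 6 ∨ t = 8) ∧ s ≠ t then 1 else 0)

set_option maxRecDepth 8000 in
/-- **The planted negative**: C-005's kernel is NOT antipodal-certified — Lemma B (`crossCount ≤
topBotCount`) is not a consequence of the chain inequalities alone (proofs/P4-BPRIME.md §4: the
entries `(⊥, 3|1)` are forced positive). -/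
theorem not_AP4_A_c005 : ¬ AP4 A_c005 := by decide +kernel

/-- The quadratic form of `A_bprime` at a row vector `π`:
`2 · (π(⊥) · π(N) - e₂(π(M₁), π(M₂), π(M₃)))`. -/
theorem quadForm4_A_bprime (π : Fin 15 → ℝ) :
    quadForm4 A_bprime π =
      2 * (π 14 * (π 0 + π 1 + π 2 + π 5 + π 9) -
        ((π 3 + π 4 + π 13) * (π 6 + π 7 + π 12) + (π 3 + π 4 + π 13) * (π 8 + π 10 + π 11) +
          (π 6 + π 7 + π 12) * (π 8 + π 10 + π 11))) := by
  simp only [quadForm4, A_bprime, Fin.sum_univ_succ, Fin.sum_univ_zero, Matrix.of_apply,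
    Matrix.cons_val_zero, Matrix.cons_val_succ, Fin.succ_zero_eq_one, Fin.succ_one_eq_two]
  push_cast
  ring

namespace MultiGraph

variable {V E : Type*} (G : MultiGraph V E) [Fintype E] [DecidableEq E]

/-- **Lemma B on the quotient `{⊥} < M₁, M₂, M₃ < N`, at every law** (the first antipodal ray):
for every finite multigraph, every `p ∈ [0,1]^E` and every four vertices, with
`M_i = P(⊥ < Π ≤ x_i)` (the crossing cell `x_i` together with the two single pairs below it) and
`N = P(Π has a block of size ≥ 3)`,
`e₂(M₁, M₂, M₃) ≤ P(a|b|c|d) · N`. Rows: `M₁ = π 3 + π 4 + π 13`, `M₂ = π 6 + π 7 + π 12`,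
`M₃ = π 8 + π 10 + π 11`, `N = π 0 + π 1 + π 2 + π 5 + π 9`, `bot = π 14`. -/
theorem bprime_law (p : E → ℝ) (hp : IsProb p) (a b c d : V) :
    (G.law4 p a b c d 3 + G.law4 p a b c d 4 + G.law4 p a b c d 13) *
          (G.law4 p a b c d 6 + G.law4 p a b c d 7 + G.law4 p a b c d 12) +
        (G.law4 p a b c d 3 + G.law4 p a b c d 4 + G.law4 p a b c d 13) *
          (G.law4 p a b c d 8 + G.law4 p a b c d 10 + G.law4 p a b c d 11) +
        (G.law4 p a b c d 6 + G.law4 p a b c d 7 + G.law4 p a b c d 12) *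
          (G.law4 p a b c d 8 + G.law4 p a b c d 10 + G.law4 p a b c d 11) ≤
      G.law4 p a b c d 14 * (G.law4 p a b c d 0 + G.law4 p a b c d 1 + G.law4 p a b c d 2 +
        G.law4 p a b c d 5 + G.law4 p a b c d 9) := by
  have h := G.quadForm4_nonneg_of_AP4 AP4_A_bprime p hp a b c d
  rw [quadForm4_A_bprime] at h
  linarith

end MultiGraph

end PercRepro
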